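import Summits.KontsevichZagierPeriods.KontsevichZagierPeriods.Theorems.GrothendieckLemniscaticSectorGlue
import Summits.KontsevichZagierPeriods.KontsevichZagierPeriods.Theorems.MzvKernelInKZ.Negative.EulerFour
import Summits.KontsevichZagierPeriods.KontsevichZagierPeriods.Theorems.MzvKernelInKZ.Negative.PiLine

/-!
# Euler's `π² = 6·ζ(2)` as a move chain (stub `stub_eulerCross2`, line `sector-amalgamation`,
# crux `Grothendieck.SectorComplement`, stmt-KontsevichZagierPeriods-11102)

The weight-2 CROSS RELATION of the amalgamation line: every representation `p` of type `(0,0,2)`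
of the lemniscatic sector — literal (vacuous) domain condition and integrand `∏_{j<2} 1/(1+xⱼ²)`
on `ℝ²`, value `π²` — is congruent modulo `KZ.relations` to `6` copies of the simplex word
representation `[Δ₂, ω₀₁]` of `ζ(2) = π²/6` (Kontsevich–Zagier's own worked example of the rules).

Proof: assembly of landed move chains, computed in the formal period ring
`P = FormalRep ⧸ relations` (`KZ.toFormalPeriod`, a `CommRing`):

* `p` is equivalent (identity change of variables, `equivalent_of_eqOn`) to the canonical monomial
  representation `m = p₁²` of type `(0,0,2)` (`exists_monoRep`), of class `⟦p₁⟧²` for a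
  representation `p₁ = [ℝ, 1/(1+x²)]` of `π` (`exists_piRep`);
* `⟦p₁⟧ = ⟦[ℝ, dt/(1+t²)]⟧ = 4·⟦[(0,1), dt/(1+t²)]⟧` (`line_univ_sub_four_mem`) and
  `⟦Q⟧ = 2·⟦[(0,1), dt/(1+t²)]⟧` (`Qrep_sub_two_line_mem`), so `⟦p₁⟧ = 2⟦Q⟧`;
* Fubini: `⟦G2⟧ = ⟦Q⟧²` (`of_Qrep_mul_of_Qrep`);
* Euler in the calculus: `3·⟦[Δ₂, ω₀₁]⟧ = 2·⟦G2⟧` (`three_zeta_two_sub_two_G2_mem`).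

Hence `⟦p⟧ = ⟦p₁⟧² = 4⟦Q⟧² = 4⟦G2⟧ = 6⟦[Δ₂, ω₀₁]⟧`, and `toFormalPeriod_eq_zero_iff` concludes.

References: L. Euler (1735), `ζ(2) = π²/6`; M. Kontsevich, D. Zagier, *Periods* (2001), §1.1–§1.2, §4.1.
-/

noncomputable section

open MeasureTheory Set
open Literature.NumberTheory.Transcendental
open Literature.NumberTheory.Transcendental.KZ
open Summit.KontsevichZagierPeriods.Grothendieck.GpcLegendreLemniscaticNegative
open Summit.KontsevichZagierPeriods.Grothendieck.LemniscaticSectorGlue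
open Summit.KontsevichZagierPeriods.MzvKernelInKZ.Negative

namespace Summit.KontsevichZagierPeriods.Grothendieck.SectorComplementAmalgamation

/-- Any representation `[ℝ, 1/(1+x²)]` of `π` has the class of the line representation
`[ℝ, dt/(1+t²)]` of `PiLine.lean` (identity change of variables). [folklore] -/
private theorem toFormalPeriod_piRep_eq_lineRep₂ (p : IntegralRep 1) (hpd : p.domain = univ)
    (hpi : p.integrand = fun x => 1 / (1 + x 0 ^ 2)) :
    toFormalPeriod (of p) = toFormalPeriod (of (lineRep univ sa_univ1)) :=
  (equivalent_of_eqOn p (lineRep univ sa_univ1)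
    ((show (lineRep univ sa_univ1).domain = univ from rfl).trans hpd.symm)
    (fun x _ => (congrFun hpi x).trans rfl)).toFormalPeriod_eq

/-- `⟦[ℝ, dt/(1+t²)]⟧ = 4·⟦[(0,1), dt/(1+t²)]⟧` in the formal period ring. [folklore] -/
private theorem toFormalPeriod_line_univ₂ :
    toFormalPeriod (of (lineRep univ sa_univ1)) = 4 • toFormalPeriod (of (lineRep L01 sa_L01)) := by
  have h := toFormalPeriod_eq_zero_of_mem line_univ_sub_four_mem
  rw [map_sub, map_nsmul] at h
  exact sub_eq_zero.mp h

/-- `⟦Q⟧ = 2·⟦[(0,1), dt/(1+t²)]⟧` in the formal period ring. [folklore] -/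
private theorem toFormalPeriod_Qrep₂ :
    toFormalPeriod (of Qrep) = 2 • toFormalPeriod (of (lineRep L01 sa_L01)) := by
  have h := toFormalPeriod_eq_zero_of_mem Qrep_sub_two_line_mem
  rw [map_sub, map_nsmul] at h
  exact sub_eq_zero.mp h

/-- Euler's `ζ(2) = π²/6` in the formal period ring: `3·⟦[Δ₂, ω₀₁]⟧ = 2·⟦G2⟧`. [folklore] -/
private theorem toFormalPeriod_three_zeta_two :
    3 • toFormalPeriod (of (wordRep ω2 1 adm_ω2)) = 2 • toFormalPeriod (of G2) := by
  have h := toFormalPeriod_eq_zero_of_mem three_zeta_two_sub_two_G2_mem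
  rw [map_sub, map_nsmul, map_nsmul] at h
  exact sub_eq_zero.mp h

/-- **Euler's `π² = 6·ζ(2)` as a move chain across the junction** (registered stub
`stub_eulerCross2` of line `sector-amalgamation`): the lemniscatic monomial representation of type
`(0,0,2)`, `[ℝ², ∏ⱼ 1/(1+xⱼ²)]` (value `π²`), is congruent to `6·[Δ₂, ω₀₁]`. Assembly of landed
chains: `[ℝ, 1/(1+t²)] ≡ 4·[(0,1), 1/(1+t²)]` (`line_univ_sub_four_mem`), `Q ≡ 2·[(0,1), 1/(1+t²)]`
(`Qrep_sub_two_line_mem`), Fubini `Q² = G2`, `3·[Δ₂, ω₀₁] ≡ 2·[G2]` (`three_zeta_two_sub_two_G2_mem`).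
[folklore] -/
theorem stub_eulerCross2 :
    ∀ (p : Literature.NumberTheory.Transcendental.KZ.IntegralRep ((0 + 0) + 2)),
      p.domain = {x | ∀ j : Fin (0 + 0), x (Fin.castAdd 2 j) ∈ Set.Ioo (0:ℝ) 1} →
      Set.EqOn p.integrand (fun x =>
        (∏ j : Fin 0, (1 / Real.sqrt ((1 - x (Fin.castAdd 2 (Fin.castAdd 0 j)) ^ 2) *
          (1 - x (Fin.castAdd 2 (Fin.castAdd 0 j)) ^ 2 / 2)))) *
        (∏ j : Fin 0, (Real.sqrt (1 - x (Fin.castAdd 2 (Fin.natAdd 0 j)) ^ 2 / 2) /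
          Real.sqrt (1 - x (Fin.castAdd 2 (Fin.natAdd 0 j)) ^ 2))) *
        ∏ j : Fin 2, (1 / (1 + x (Fin.natAdd (0 + 0) j) ^ 2))) p.domain →
      6 • Literature.NumberTheory.Transcendental.KZ.of
          (Summit.KontsevichZagierPeriods.MzvKernelInKZ.Negative.wordRep
            Summit.KontsevichZagierPeriods.MzvKernelInKZ.Negative.ω2 1
            Summit.KontsevichZagierPeriods.MzvKernelInKZ.Negative.adm_ω2) -
        Literature.NumberTheory.Transcendental.KZ.of p ∈
        Literature.NumberTheory.Transcendental.KZ.relations := by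
  intro p hpdom hpint
  obtain ⟨p₁, hpd, hpi⟩ := exists_piRep
  obtain ⟨m, hmd, hmi, hmP⟩ := exists_monoRep p₁ hpd hpi 0 0 2
  simp only [pow_zero, one_mul] at hmP
  -- `p` is the canonical monomial representation `m` up to an identity change of variables
  have hpm : toFormalPeriod (of p) = toFormalPeriod (of m) :=
    (equivalent_of_eqOn p m (by rw [hmd, hpdom]) (by rw [hmi]; exact hpint)).toFormalPeriod_eq
  have hp₁ := toFormalPeriod_piRep_eq_lineRep₂ p₁ hpd hpi
  have hU := toFormalPeriod_line_univ₂
  have hQ := toFormalPeriod_Qrep₂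
  have hG2 : toFormalPeriod (of G2) = toFormalPeriod (of Qrep) * toFormalPeriod (of Qrep) := by
    rw [← map_mul, of_Qrep_mul_of_Qrep]
  have h32 := toFormalPeriod_three_zeta_two
  rw [← toFormalPeriod_eq_zero_iff, map_sub, map_nsmul, hpm, hmP, hp₁]
  set W := toFormalPeriod (of (wordRep ω2 1 adm_ω2))
  set G' := toFormalPeriod (of G2)
  set Q := toFormalPeriod (of Qrep)
  set U := toFormalPeriod (of (lineRep univ sa_univ1))
  set A := toFormalPeriod (of (lineRep L01 sa_L01))
  simp only [nsmul_eq_mul, Nat.cast_ofNat] at hU hQ h32 ⊢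
  linear_combination 2 * h32 + 4 * hG2 + 4 * (Q + 2 * A) * hQ - (U + 4 * A) * hU

end Summit.KontsevichZagierPeriods.Grothendieck.SectorComplementAmalgamation

end
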